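import Summits.QuantumFields.BalabanUV.Beta.D1BFx.GhostStencilDivergence

/-!
# `BalabanUV.Beta.D1BFx.GhostLegWard` — road «BF-x» for binder row D1, sub-leaf A4-leg-PARITY-gh (part 5b): THE FIRST-ORDER WARD SOCKET
# (W1) OF `FineHessianWard.bondSecondMoment_Pgh_eq_avgM2_of_laws` DISCHARGED FOR T6 v1's STENCIL AND T2's LEG —
# `(Ggh ∘ divV (Sgh n (c·n²) (c·a)) u) ∘ Ggh = Ggh ∘ X u − X u ∘ Ggh` with the generator `X u = (−c) • δ_u`, every `n ≥ 1`, `0 < a`, `c ∈ ℝ`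

HONEST DEPENDENCY (page 1, mandatory): continuum YM on T⁴ ⇐ BetaPertH ∧ nine spine estimates (0/9 proved); BetaPertH ⇐ (D1) ∧ (D4) ∧
CAP+tail; G-an2-4 gates asym, D1 and NE2/3/4.  HONEST FRAMING (cell contract, verbatim): «discharging `BetaPertH` makes Bałaban's UV
stability UNCONDITIONAL — a real constructive-QFT result; it is NOT the continuum limit and NOT the Clay problem.»  THIS FILE DISCHARGES
NOTHING of D1 / BetaPertH: [folklore] bookkeeping — the resolvent identity on `ℤ⁴` for the typer's T2 leg `Ggh` (two-sided inverse of the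
site matrix, `GhostLeg.tsum_Ggh_mul_AX` / `tsum_AX_mul_Ggh` BY NAME) applied to part 5a's operator statement `divV_Sgh_eq`.  No definition,
no `def … : Prop`, no citation, nothing printed; 0 binders of the hR root are touched.  It fills ONE hypothesis (`hW1`) of a LEAF-level END
of the road BF-x for leaf-04's ghost kernel; the other sockets of that END (`hW2`, `hSr` at `cQ ≠ 0`, `hTr`) are shown UNFILLABLE for T6 v1
as typed in parts 2–4 (GAPS § C-d1leaf01-g3-1) — so nothing of node R5 closes by this file.
ABSOLUTE RULE (cell charter, verbatim): «No internally-minted statement may enter as a cited fact. Every hypothesis is either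
kernel-proved in this package or a verbatim quotation of a PUBLISHED theorem with page reference. The manuscript(s) under audit are NOT
citable for their own disputed steps — they are the thing under adjudication; programme-internal (2001/route/tribunal) claims are never
citable.»

CONTENT.
* §1 [folklore] finite-support summability of the site matrix's rows/columns against any kernel; the two contractions
  `Σ'_w Ggh x w·(O w u·[z=u] − [w=u]·O u z) = [z=u]·[x=u] − Ggh x u·O u z` (`comp_Ggh_comm_apply`) and
  `Σ'_z ([z=u]·[x=u] − Ggh x u·O u z)·Ggh z y = [x=u]·Ggh u y − Ggh x u·[y=u]` (`comm_resolvent_apply`).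
* §2 [folklore] **`ward₁_Ggh`**: the END's `hW1` VERBATIM for `(cK, cQ) = (c·n², c·a)` and `X u = (−c) • genX u` (with part 4's
  `biLoc_genX` the END's `hX` holds for `X` with constant `|c|`, `biLoc_smul_genX`).  READING (prose): the kernel form of the typer's CHECK-N0
  units line «`(cK, cQ) = (n², a)` up to colour weight and sign» — (W1) holds exactly on the ray `cQ/cK = a/n²`, for the CORNER-rooted
  `Q′(U)`-jet as typed (gauge covariance does not see the root; parity does — parts 2–3).
Unit `b2b-balaban-beta-d1-formalise-leaf-01` (gen 3).
-/

noncomputable section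

namespace Summit.QuantumFields.BalabanUV.Beta.D1BFx.GhostLegWard

open Finset
open scoped BigOperators
open Literature.MathematicalPhysics.QuantumFieldTheory.Balaban1983to89
open Literature.MathematicalPhysics.QuantumFieldTheory.Balaban1983to89.Beta
open B12Sec2to5 (l1)
open B6QGQLower276 (AX AX_symm)
open B5Hk103ScalarZd (nbhd AX_eq_zero_of_not_mem)
open ExpKernelCalculus (Site MKer BiLoc comp)
open KernelWard (divV)
open Summit.QuantumFields.BalabanUV.Beta.D1BFx.GhostLeg (Ggh tsum_Ggh_mul_AX tsum_AX_mul_Ggh)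
open Summit.QuantumFields.BalabanUV.Beta.D1BFx.GhostStencil (Sgh)
open Summit.QuantumFields.BalabanUV.Beta.D1BFx.GhostStencilWard (genX genX_apply comp_genX_left comp_genX_right comp_unit_apply biLoc_genX)
open Summit.QuantumFields.BalabanUV.Beta.D1BFx.GhostStencilDivergence (Oker divV_Sgh_eq)

variable (n : ℕ) (a : ℝ)

/-! ## §1 Finite-support summability and the two contractions -/

/-- [folklore] `Oker` is the site matrix, entrywise. -/
theorem Oker_eq_AX (x z : Site 4) (p q : Unit) : Oker n a x z p q = AX (n - 1) a x z := rfl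

/-- [folklore] A row of the site matrix against any function is a finitely supported, hence summable, family. -/
theorem summable_AX_row_mul (u : Site 4) (g : Site 4 → ℝ) : Summable fun z : Site 4 => AX (n - 1) a u z * g z :=
  summable_of_ne_finset_zero (s := nbhd (n - 1) u) fun z hz => by rw [AX_eq_zero_of_not_mem a hz, zero_mul]

/-- [folklore] A column of the (symmetric) site matrix against any function is summable. -/
theorem summable_mul_AX_col (u : Site 4) (g : Site 4 → ℝ) : Summable fun w : Site 4 => g w * AX (n - 1) a w u :=
  summable_of_ne_finset_zero (s := nbhd (n - 1) u) fun w hw => by rw [AX_symm, AX_eq_zero_of_not_mem a hw, mul_zero]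

/-- [folklore] A one-point family is summable. -/
theorem summable_ite_point (u : Site 4) (g : Site 4 → ℝ) : Summable fun w : Site 4 => if w = u then g w else 0 :=
  summable_of_ne_finset_zero (s := ({u} : Finset (Site 4))) fun w hw => by
    rw [Finset.mem_singleton] at hw
    rw [if_neg hw]

/-- [folklore] **FIRST CONTRACTION**: `(Ggh ∘ (O ∘ δ_u − δ_u ∘ O))(x,z) = [z=u]·[x=u] − Ggh x u · O u z` (`Ggh ∘ O = 𝟙`, `GhostLeg.tsum_Ggh_mul_AX`). -/
theorem comp_Ggh_comm_apply [NeZero n] (ha : 0 < a) (u x z : Site 4) (p q : Unit) :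
    comp (Ggh n a) (comp (Oker n a) (genX u) - comp (genX u) (Oker n a)) x z p q
      = (if z = u then (1 : ℝ) else 0) * (if x = u then 1 else 0) - Ggh n a x u () () * AX (n - 1) a u z := by
  rw [comp_unit_apply]
  have hf : ∀ w : Site 4, Ggh n a x w () () * (comp (Oker n a) (genX u) - comp (genX u) (Oker n a)) w z () ()
      = (if z = u then (1 : ℝ) else 0) * (Ggh n a x w () () * AX (n - 1) a w u)
        - (if w = u then Ggh n a x w () () * AX (n - 1) a u z else 0) := by
    intro w
    rw [Pi.sub_apply, Pi.sub_apply, Pi.sub_apply, Pi.sub_apply, comp_genX_right, comp_genX_left, Oker_eq_AX, Oker_eq_AX]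
    by_cases hw : w = u
    · subst hw; rw [if_pos rfl, if_pos rfl]; ring
    · rw [if_neg hw, if_neg hw]; ring
  rw [tsum_congr hf, Summable.tsum_sub ((summable_mul_AX_col n a u _).mul_left _) (summable_ite_point u _), tsum_mul_left,
    tsum_Ggh_mul_AX n a ha x u () (), tsum_ite_eq]

/-- [folklore] **SECOND CONTRACTION**: `Σ'_z ([z=u]·[x=u] − Ggh x u·O u z)·Ggh z y = [x=u]·Ggh u y − Ggh x u·[y=u]` (`O ∘ Ggh = 𝟙`,
`GhostLeg.tsum_AX_mul_Ggh`). -/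
theorem comm_resolvent_apply [NeZero n] (ha : 0 < a) (u x y : Site 4) :
    (∑' z : Site 4, ((if z = u then (1 : ℝ) else 0) * (if x = u then 1 else 0) - Ggh n a x u () () * AX (n - 1) a u z) * Ggh n a z y () ())
      = (if x = u then (1 : ℝ) else 0) * Ggh n a u y () () - Ggh n a x u () () * (if y = u then 1 else 0) := by
  have hf : ∀ z : Site 4, ((if z = u then (1 : ℝ) else 0) * (if x = u then 1 else 0) - Ggh n a x u () () * AX (n - 1) a u z) * Ggh n a z y () ()
      = (if z = u then (if x = u then (1 : ℝ) else 0) * Ggh n a z y () () else 0)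
        - Ggh n a x u () () * (AX (n - 1) a u z * Ggh n a z y () ()) := by
    intro z
    by_cases hz : z = u
    · subst hz; rw [if_pos rfl, if_pos rfl]; ring
    · rw [if_neg hz, if_neg hz]; ring
  rw [tsum_congr hf, Summable.tsum_sub (summable_ite_point u _) ((summable_AX_row_mul n a u _).mul_left _), tsum_ite_eq, tsum_mul_left,
    tsum_AX_mul_Ggh n a ha u y () ()]
  by_cases hy : y = u
  · subst hy; rw [if_pos rfl]
  · rw [if_neg hy, if_neg (fun h : u = y => hy h.symm)]

/-! ## §2 The END's first-order Ward socket for the ghost sector -/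

/-- [folklore] The END's `hX` shape for the scaled generator: `BiLoc ((−c) • genX u) u u |c| δ` (every real `δ`). -/
theorem biLoc_smul_genX (c : ℝ) (u : Site 4) (δ : ℝ) : BiLoc ((-c) • genX u) u u |c| δ := by
  intro x z p q
  have h := biLoc_genX u δ x z p q
  rw [Pi.smul_apply, Pi.smul_apply, Pi.smul_apply, Pi.smul_apply, smul_eq_mul, abs_mul, abs_neg]
  calc |c| * |genX u x z p q| ≤ |c| * (1 * Real.exp (-δ * (l1 (x - u) + l1 (z - u)))) :=
        mul_le_mul_of_nonneg_left h (abs_nonneg c)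
    _ = |c| * Real.exp (-δ * (l1 (x - u) + l1 (z - u))) := by rw [one_mul]

/-- [folklore] **(W1) FOR T2's GHOST LEG AND T6 v1's STENCIL** — the hypothesis `hW1` of `FineHessianWard.bondSecondMoment_Pgh_eq_avgM2_of_laws`
VERBATIM at the weights `(cK, cQ) = (c·n², c·a)` with the generator family `X u := (−c) • genX u`:
`(Ggh ∘ divV (Sgh n (c·n²) (c·a)) u) ∘ Ggh = Ggh ∘ X u − X u ∘ Ggh` (`0 < a`, every `n ≥ 1`, every real `c`). -/
theorem ward₁_Ggh [NeZero n] (ha : 0 < a) (c : ℝ) (u : Site 4) :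
    comp (comp (Ggh n a) (divV (Sgh n (c * (n : ℝ) ^ 2) (c * a)) u)) (Ggh n a)
      = comp (Ggh n a) ((-c) • genX u) - comp ((-c) • genX u) (Ggh n a) := by
  rw [divV_Sgh_eq, KernelReflection.comp_smul_right, KernelReflection.comp_smul_left, KernelReflection.comp_smul_right,
    KernelReflection.comp_smul_left]
  funext x y p q
  obtain rfl : p = () := Subsingleton.elim _ _
  obtain rfl : q = () := Subsingleton.elim _ _
  rw [Pi.smul_apply, Pi.smul_apply, Pi.smul_apply, Pi.smul_apply, smul_eq_mul, Pi.sub_apply, Pi.sub_apply, Pi.sub_apply,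
    Pi.sub_apply, Pi.smul_apply, Pi.smul_apply, Pi.smul_apply, Pi.smul_apply, Pi.smul_apply, Pi.smul_apply, Pi.smul_apply,
    Pi.smul_apply, smul_eq_mul, smul_eq_mul, comp_genX_right, comp_genX_left,
    comp_unit_apply (comp (Ggh n a) _) (Ggh n a)]
  have hf : ∀ z : Site 4, comp (Ggh n a) (comp (Oker n a) (genX u) - comp (genX u) (Oker n a)) x z () () * Ggh n a z y () ()
      = ((if z = u then (1 : ℝ) else 0) * (if x = u then 1 else 0) - Ggh n a x u () () * AX (n - 1) a u z) * Ggh n a z y () () :=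
    fun z => by rw [comp_Ggh_comm_apply n a ha]
  rw [tsum_congr hf, comm_resolvent_apply n a ha]
  ring

end Summit.QuantumFields.BalabanUV.Beta.D1BFx.GhostLegWard

end
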